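import Mathlib
import Summits.Ventures.PercRepro.TriangleCapFourRowThreeCap
import Summits.Ventures.PercRepro.TriangleCapThirdOrderTen
import Summits.Ventures.PercRepro.TriangleCapFourRowTwo

/-!
# PercRepro — THE PIECES OF THE ROW `a = 4` AT `r = 3`: the side lemma of the deletion of a vertex onto a
`4`-bipartite `D − z`, and the arithmetic of the five deletions (p3, gen 46; part 199c)

For the induction of part 199d on the cell `(k, 4, 3)` (`k ≥ 11`; target `Σ_v d(v)² + 3 (k − 4) + (2k − 18) ≤ m k`,
i.e. the non-bipartite gap `B2 = 2k − 18` of §10bt(e)) a vertex `z` of degree `d ≤ 4` is deleted and `D − z` is read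
on its cell at `k − 1`: `d = 0` on `(k − 1, 5, k − 11)` (the closed form), `d = 1` on the diagonal `(k − 1, 4, 0)`,
`d = 2` on `(k − 1, 4, 1)`, `d = 3` on `(k − 1, 4, 2)`, `d = 4` on `(k − 1, 4, 3)` (the induction hypothesis; at
`k = 11` the third order of part 199a). Whenever `D − z` is `4`-bipartite with the `4`-side `A'`
(`four_three_sides`): the neighbours of `z` all in `A'` make `D` `4`-bipartite (`bipSub_lift`), all off `A'` make
`D` `5`-bipartite with `k − 6` missing pairs, whose closed form `5 (k − 6) = 3 (k − 4) + (2k − 18)` IS the target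
(`bipSub_insert_of_nbhd_off`, `sum_deg_sq_le_of_bipSub`), and otherwise a neighbour off `A'` has degree `≤ 4` in
`D − z`, so `T ≤ (d − 1)(k − 6) + 4` (`sum_le_of_mem_le`). The arithmetic lemmas close each count with the slack
recorded in their docstrings. Axioms: standard.
-/

namespace PercRepro

namespace TriangleCap

namespace C047

open Finset

variable {V : Type*} [Fintype V] [DecidableEq V]

/-- A sum over `N` of values `≤ c`, one of which (`w₀ ∈ N`) is `≤ 4`, is at most `c (|N| − 1) + 4`. -/
theorem sum_le_of_mem_le {W : Type*} [DecidableEq W] (N : Finset W) (f : W → ℕ) (c : ℕ) {w₀ : W} (hw₀ : w₀ ∈ N)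
    (hf : ∀ w ∈ N, f w ≤ c) (h0 : f w₀ ≤ 4) : ∑ w ∈ N, f w + c ≤ N.card * c + 4 := by
  rw [← add_sum_erase N f hw₀]
  have h1 : ∑ w ∈ N.erase w₀, f w ≤ ∑ _w ∈ N.erase w₀, c :=
    sum_le_sum (fun w hw => hf w (mem_of_mem_erase hw))
  rw [sum_const, smul_eq_mul, card_erase_of_mem hw₀] at h1
  have h2 : 1 ≤ N.card := card_pos.mpr ⟨w₀, hw₀⟩
  have h3 : (N.card - 1) * c + c = N.card * c := by
    obtain ⟨n, hn⟩ : ∃ n, N.card = n + 1 := ⟨N.card - 1, by omega⟩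
    rw [hn, Nat.add_sub_cancel]
    ring
  omega

/-- **THE SIDES OF A `4`-BIPARTITE `D − z` ON THE CELL `(k, 4, 3)`:** `D` is `4`-bipartite, or `D` is `5`-bipartite
with `k − 6` missing pairs and at the target, or a neighbour of `z` lies off the `4`-side and
`T + (k − 6) ≤ d(z) (k − 6) + 4`. -/
theorem four_three_sides (D : SimpleGraph V) [DecidableRel D.Adj] (hk : 11 ≤ Fintype.card V)
    (hm : D.edgeFinset.card + 3 = 4 * (Fintype.card V - 4)) (z : V) (A' : Finset {v : V // v ≠ z})
    (hA'card : A'.card = 4) (hB : BipSub (del D z) A') (hcap6 : ∀ v, deg D v ≤ (Fintype.card V - 6) + 1) :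
    (∃ A : Finset V, A.card = 4 ∧ BipSub D A) ∨
      (∑ v, deg D v * deg D v + 3 * (Fintype.card V - 4) + (2 * Fintype.card V - 18) ≤
        D.edgeFinset.card * Fintype.card V) ∨
      (∑ a : {v : V // v ≠ z}, (if D.Adj a.1 z then deg (del D z) a else 0) + (Fintype.card V - 6) ≤
        deg D z * (Fintype.card V - 6) + 4) := by
  by_cases hall : ∀ a : {v : V // v ≠ z}, D.Adj a.1 z → a ∈ A'
  · obtain ⟨B, hBcard, hBsub⟩ := bipSub_lift D z A' hB hall
    exact Or.inl ⟨B, by rw [hBcard, hA'card], hBsub⟩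
  by_cases hnone : ∀ a : {v : V // v ≠ z}, D.Adj a.1 z → a ∉ A'
  · right; left
    obtain ⟨A, hAcard, hAsub⟩ := bipSub_insert_of_nbhd_off D z A' hB hnone
    rw [hA'card] at hAcard
    have h := sum_deg_sq_le_of_bipSub D A hAsub 5 (Fintype.card V - 6) hAcard (by omega) (by omega)
    have e : Fintype.card V - 1 - (Fintype.card V - 6) = 5 := by omega
    rw [e] at h
    omega
  · right; right
    push Not at hall
    obtain ⟨w₀, hw₀z, hw₀A⟩ := hall
    obtain ⟨Nz, hNzdef⟩ : ∃ Nz : Finset {v : V // v ≠ z},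
        Nz = univ.filter (fun a : {v : V // v ≠ z} => D.Adj a.1 z) := ⟨_, rfl⟩
    have hmemNz : ∀ a : {v : V // v ≠ z}, a ∈ Nz ↔ D.Adj a.1 z := fun a => by
      rw [hNzdef, mem_filter]
      simp only [mem_univ, true_and]
    have hNz : Nz.card = deg D z := by rw [hNzdef]; exact card_nbhd_del D z
    have hTfilt : ∑ a : {v : V // v ≠ z}, (if D.Adj a.1 z then deg (del D z) a else 0) =
        ∑ a ∈ Nz, deg (del D z) a := by
      rw [hNzdef, sum_filter]
    rw [hTfilt, ← hNz]
    have hdw₀ : deg (del D z) w₀ ≤ 4 := by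
      have := deg_le_card_of_bipSub (del D z) A' hB w₀ hw₀A
      rw [hA'card] at this
      exact this
    exact sum_le_of_mem_le Nz (fun a => deg (del D z) a) (Fintype.card V - 6) ((hmemNz w₀).mpr hw₀z)
      (fun a ha => by
        have h := deg_del D z a
        rw [if_pos ((hmemNz a).mp ha)] at h
        have := hcap6 a.1
        omega) hdw₀

/-- `d = 0`: `D − z` on `(k − 1, 5, k − 11)`: `S' + 9 (k − 11) ≤ m (k − 1)` closes with slack `8k − 88`. -/
theorem four_three_del_zero_arith (s m' S' T : ℕ) (hm' : m' = 4 * s + 25)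
    (hS' : S' + (s + 11 - 11) * 9 ≤ m' * (s + 10)) (hT : T ≤ 0 * (s + 11 - 6)) :
    S' + 2 * T + 0 + 0 * 0 + 3 * (s + 11 - 4) + (2 * (s + 11) - 18) ≤ (m' + 0) * (s + 11) := by
  subst hm'
  have e1 : s + 11 - 11 = s := by omega
  have e2 : s + 11 - 4 = s + 7 := by omega
  have e3 : 2 * (s + 11) - 18 = 2 * s + 4 := by omega
  rw [e1] at hS'
  rw [e2, e3]
  have hT0 : T = 0 := by omega
  subst hT0
  nlinarith [hS']

/-- `d = 1`, `D − z = K_{4,k−5}` with the neighbour of `z` on the large side: `S' ≤ m' (k − 1)`, `T ≤ 4`: exact. -/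
theorem four_three_del_one_bip_arith (s m' S' T : ℕ) (hm' : m' = 4 * s + 24) (hS' : S' ≤ m' * (s + 10)) (hT : T ≤ 4) :
    S' + 2 * T + 1 + 1 * 1 + 3 * (s + 11 - 4) + (2 * (s + 11) - 18) ≤ (m' + 1) * (s + 11) := by
  subst hm'
  have e2 : s + 11 - 4 = s + 7 := by omega
  have e3 : 2 * (s + 11) - 18 = 2 * s + 4 := by omega
  rw [e2, e3]
  nlinarith [hS', hT]

/-- `d = 1`, `D − z` not `4`-bipartite: `S' + 8 (k − 10) ≤ m' (k − 1)`, `T ≤ k − 6`: slack `6k − 60`. -/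
theorem four_three_del_one_gap_arith (s m' S' T : ℕ) (hm' : m' = 4 * s + 24)
    (hS' : S' + 2 * 4 * (s + 10 - 2 * 4 - 1) ≤ m' * (s + 10)) (hT : T ≤ 1 * (s + 11 - 6)) :
    S' + 2 * T + 1 + 1 * 1 + 3 * (s + 11 - 4) + (2 * (s + 11) - 18) ≤ (m' + 1) * (s + 11) := by
  subst hm'
  have e1 : s + 10 - 2 * 4 - 1 = s + 1 := by omega
  have e2 : s + 11 - 4 = s + 7 := by omega
  have e3 : 2 * (s + 11) - 18 = 2 * s + 4 := by omega
  have e4 : s + 11 - 6 = s + 5 := by omega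
  rw [e1] at hS'
  rw [e4] at hT
  rw [e2, e3]
  nlinarith [hS', hT]

/-- The mixed deletion `d = 2` onto a `4`-bipartite `D − z` on `(k − 1, 4, 1)`: `S' + (k − 3) ≤ m' (k − 1)`,
`T + (k − 6) ≤ 2 (k − 6) + 4`: slack `4`. -/
theorem four_three_del_two_mixed_arith (s m' S' T : ℕ) (hm' : m' = 4 * s + 23)
    (hS' : S' + 1 * (s + 10 - 1 - 1) ≤ m' * (s + 10)) (hT : T + (s + 11 - 6) ≤ 2 * (s + 11 - 6) + 4) :
    S' + 2 * T + 2 + 2 * 2 + 3 * (s + 11 - 4) + (2 * (s + 11) - 18) ≤ (m' + 2) * (s + 11) := by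
  subst hm'
  have e1 : s + 10 - 1 - 1 = s + 8 := by omega
  have e2 : s + 11 - 4 = s + 7 := by omega
  have e3 : 2 * (s + 11) - 18 = 2 * s + 4 := by omega
  have e4 : s + 11 - 6 = s + 5 := by omega
  rw [e1] at hS'
  rw [e4] at hT
  rw [e2, e3]
  nlinarith [hS', hT]

/-- The mixed deletion `d = 3` onto a `4`-bipartite `D − z` on `(k − 1, 4, 2)`: `S' + 2 (k − 4) ≤ m' (k − 1)`,
`T + (k − 6) ≤ 3 (k − 6) + 4`: slack `4`. -/
theorem four_three_del_three_mixed_arith (s m' S' T : ℕ) (hm' : m' = 4 * s + 22)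
    (hS' : S' + 2 * (s + 10 - 1 - 2) ≤ m' * (s + 10)) (hT : T + (s + 11 - 6) ≤ 3 * (s + 11 - 6) + 4) :
    S' + 2 * T + 3 + 3 * 3 + 3 * (s + 11 - 4) + (2 * (s + 11) - 18) ≤ (m' + 3) * (s + 11) := by
  subst hm'
  have e1 : s + 10 - 1 - 2 = s + 7 := by omega
  have e2 : s + 11 - 4 = s + 7 := by omega
  have e3 : 2 * (s + 11) - 18 = 2 * s + 4 := by omega
  have e4 : s + 11 - 6 = s + 5 := by omega
  rw [e1] at hS'
  rw [e4] at hT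
  rw [e2, e3]
  nlinarith [hS', hT]

/-- The mixed deletion `d = 4` onto a `4`-bipartite `D − z` on `(k − 1, 4, 3)`: `S' + 3 (k − 5) ≤ m' (k − 1)`,
`T + (k − 6) ≤ 4 (k − 6) + 4`: exact. -/
theorem four_three_del_four_mixed_arith (s m' S' T : ℕ) (hm' : m' = 4 * s + 21)
    (hS' : S' + 3 * (s + 10 - 1 - 3) ≤ m' * (s + 10)) (hT : T + (s + 11 - 6) ≤ 4 * (s + 11 - 6) + 4) :
    S' + 2 * T + 4 + 4 * 4 + 3 * (s + 11 - 4) + (2 * (s + 11) - 18) ≤ (m' + 4) * (s + 11) := by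
  subst hm'
  have e1 : s + 10 - 1 - 3 = s + 6 := by omega
  have e2 : s + 11 - 4 = s + 7 := by omega
  have e3 : 2 * (s + 11) - 18 = 2 * s + 4 := by omega
  have e4 : s + 11 - 6 = s + 5 := by omega
  rw [e1] at hS'
  rw [e4] at hT
  rw [e2, e3]
  nlinarith [hS', hT]

/-- `d = 2`, `D − z` not `4`-bipartite on `(k − 1, 4, 1)`: `S' + (k − 3) + 6 (k − 10) ≤ m' (k − 1)`, `T ≤ 2 (k − 6)`:
slack `4k − 36`. -/
theorem four_three_del_two_gap_arith (s m' S' T : ℕ) (hm' : m' = 4 * s + 23)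
    (hS' : S' + (s + 10 - 2) + 2 * (s + 10 - 2 * 4 - 1) * (4 - 1) ≤ m' * (s + 10)) (hT : T ≤ 2 * (s + 11 - 6)) :
    S' + 2 * T + 2 + 2 * 2 + 3 * (s + 11 - 4) + (2 * (s + 11) - 18) ≤ (m' + 2) * (s + 11) := by
  subst hm'
  have e1 : s + 10 - 2 * 4 - 1 = s + 1 := by omega
  have e1' : s + 10 - 2 = s + 8 := by omega
  have e2 : s + 11 - 4 = s + 7 := by omega
  have e3 : 2 * (s + 11) - 18 = 2 * s + 4 := by omega
  have e4 : s + 11 - 6 = s + 5 := by omega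
  rw [e1, e1'] at hS'
  rw [e4] at hT
  rw [e2, e3]
  nlinarith [hS', hT]

/-- `d = 3`, `D − z` not `4`-bipartite on `(k − 1, 4, 2)`: `S' + 2 (k − 4) + 2 (k − 10) ≤ m' (k − 1)`,
`T ≤ 3 (k − 6)`: slack `4`. -/
theorem four_three_del_three_gap_arith (s m' S' T : ℕ) (hm' : m' = 4 * s + 22)
    (hS' : S' + 2 * (s + 10 - 3) + 2 * (s + 10 - 9) ≤ m' * (s + 10)) (hT : T ≤ 3 * (s + 11 - 6)) :
    S' + 2 * T + 3 + 3 * 3 + 3 * (s + 11 - 4) + (2 * (s + 11) - 18) ≤ (m' + 3) * (s + 11) := by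
  subst hm'
  have e1 : s + 10 - 3 = s + 7 := by omega
  have e1' : s + 10 - 9 = s + 1 := by omega
  have e2 : s + 11 - 4 = s + 7 := by omega
  have e3 : 2 * (s + 11) - 18 = 2 * s + 4 := by omega
  have e4 : s + 11 - 6 = s + 5 := by omega
  rw [e1, e1'] at hS'
  rw [e4] at hT
  rw [e2, e3]
  nlinarith [hS', hT]

/-- `d = 4`, `D − z` not `4`-bipartite on `(k − 1, 4, 3)` at the induction hypothesis:
`S' + 3 (k − 5) + (2k − 20) ≤ m' (k − 1)`, `T ≤ 4 (k − 6)`: exact. -/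
theorem four_three_del_four_gap_arith (s m' S' T : ℕ) (hm' : m' = 4 * s + 21)
    (hS' : S' + 3 * (s + 10 - 4) + (2 * (s + 10) - 18) ≤ m' * (s + 10)) (hT : T ≤ 4 * (s + 11 - 6)) :
    S' + 2 * T + 4 + 4 * 4 + 3 * (s + 11 - 4) + (2 * (s + 11) - 18) ≤ (m' + 4) * (s + 11) := by
  subst hm'
  have e1 : s + 10 - 4 = s + 6 := by omega
  have e1' : 2 * (s + 10) - 18 = 2 * s + 2 := by omega
  have e2 : s + 11 - 4 = s + 7 := by omega
  have e3 : 2 * (s + 11) - 18 = 2 * s + 4 := by omega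
  have e4 : s + 11 - 6 = s + 5 := by omega
  rw [e1, e1'] at hS'
  rw [e4] at hT
  rw [e2, e3]
  nlinarith [hS', hT]

/-- `d = 4` at `k = 11`, `D − z` neither `3`- nor `4`-bipartite on `(10, 21)`: `S' ≤ 190`, `T ≤ 20`: exact. -/
theorem four_three_del_four_ten_arith (S' T : ℕ) (hS' : S' + 20 ≤ 21 * 10) (hT : T ≤ 4 * (11 - 6)) :
    S' + 2 * T + 4 + 4 * 4 + 3 * (11 - 4) + (2 * 11 - 18) ≤ 25 * 11 := by
  omega

end C047

end TriangleCap

end PercRepro
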